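import Summits.ResolutionOfSingularities.ResolutionOfSingularities.Theorems.EquisingularLiftEquisingularLiftNatResidueHypDefs7
import HarnessLib

/-!
# [OURS · L1 W4.5(b) · EL♮ / EL♮(3)] RESIDUE HYPOTHESIS DEFS E — door ν4 «EQUINODAL PLANAR NOSE» (WIDTH TABLE D6, row D6-4, desk R52/R56):
# `EqCertAt₀` / `EqCertDet` (the downstairs certificate (CERT-EQ)), the door `ReachEquinodalPlanarNose`, the blob `NoseHypHostedNestEquinodalBTriplePrime`
# and the inclusion `NoseHypHostedNestBTriplePrime₂ → NoseHypHostedNestEquinodalBTriplePrime`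

Typed by res-L1-w45b-nose-w1 g3 on the W4.5b desk's RE-DEAL (D6-4) (R56, 2026-08-28T21:36:24Z) by the …NatResidueHypDefs7 PATTERN (one more closure rule
on the motive; new module, new names; nothing in Defs5/6/7 edited).  PLAN OF RECORD: NU4-SIZING v5 f7486aab0e6e06a9 (pen res-L1-w45b-idea-2 g26 §0; §M
res-L1-w45b-idea-3 g14; §C res-L1-w45b-nose-w4; §E res-L1-w45b-stub-2), door template = idea-2's Sketch v3 1d7d57a44f30e82a `ReachEquinodalPlanarNose`, certificate
template = idea-3's `NU4_certEq_sketch.lean` 0efc2d2c05e81442, with the desk's adopted deltas: (§C C1.3) the door's INNER motive is closed ALSO under the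
stage-level HOSTED ROUND (Defs7's binder list VERBATIM — crit-3's «zero-risk choice», l.83533) so that the in-host lines `ℓᵢ = Eᵢ ∩ St Π` left singular
by the node steps are rounded; (crit-2 l.83581 / crit-3 S-1 / nose-w4 l.83589 / idea-3 (5)) ONE GLOBAL CHART: hyperplane coordinates `B` are the customer's
free choice and every marked node is normalised in the THIRD coordinate (`c.val = 2`), the Hessian block is taken in the first two (`a.val = 0`, `b.val = 1`)
— for n = 3 this is `c = 2, a = 0, b = 1 : Fin 3`, i.e. EXACTLY the input convention of the (S1) supplier `Equinodal.exists_equinodal_lift` (✓ p670351);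
(crit-3 r47 (D)) NO free node-predicate parameter: ordinariness is the CONCRETE Hessian clause of `EqCertAt₀`, and its cover clause says the marked vectors
ARE the non-regular closed points of `Z̃` — so the stalk-level `OrdNodeIn` of the sketch is not carried (nothing downstream reads it; the upstairs supplier reads
coordinates).  WORD OF RECORD it must host (§C C1, customer S_ν(6;10)^{Ch}): EQNOSE_Π[(P(nᵢ)·N(ℓᵢ))_{i≤10} · HNOSE(St 𝒵_O)]·[tail ∅].
House style R21″ (C): definitions + pure-logic lemmas; no `sorry`, no instance, no notation; standard axioms.
OURS; NAMED HYPOTHESES (abbreviations of statement fragments of OUR equisingular-lift route), not statements of any manuscript; nothing of [Hironaka2017]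
is asserted; AI-written, weaker than expert review; EL♮(3) is NOT proved here; resolution of singularities in positive characteristic is NOT proved here
(dimension 3 is Cossart–Piltant 2008/2009 in print).  `--kind definition --supports stmt-ResolutionOfSingularities-20148 --as helper`.

MEANING of `ReachEquinodalPlanarNose k n ℓ T₁ F₉ β T₉ E₉` (the door, INITIAL STAGE ONLY, host `Π = V₊(ℓ)`): there is a closed, infinite, irreducible
`Z ⊆ T₁ ∩ Π`, `T₁ ⊄ Z`, with one-dimensional closed-point stalks of `Z̃`, ambient `ℙⁿ` and host `Π̃` regular along `Z̃`, host two-dimensional along `Z`,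
carrying the certificate `EqCertAt₀ k n ℓ Z hZ` (below); and a SUB-CHAIN: an inner motive `R G γ T E W` over `ℙⁿ` (strict transform `T`, host transform
`E`, nose transform `W`; initially `(T₁, Π, Z)`) closed under (pt) the blow-up of a NON-REGULAR closed point of `W̃` and (rd) the stage-level HOSTED ROUND of
Defs7 (a regular curve `Z' ⊆ closure E`, `Z' ⊆ T`, `T ⊄ Z'`, host regular along it, `DirStepUnobs G (closure E) _ Z' _`, curve clause) reaches a stage
`(F₂, υ, T₂, E₂, Z₂)` with `Z̃₂` REGULAR; then the blow-up `υ'` of `𝓘⟨Z₂⟩` (NO unobstructedness clause: upstairs the centre is the GIVEN strict transform of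
the equinodal lift); then a B‴ tail (`TowerPtRegB₄` / `TowerPtRamB₄` / `TowerRoundBTriplePrime`) reaching `(F₉, γ', T₉, …)`; `β = (γ' ≫ υ') ≫ υ`; the host is
dropped, `E₉ = ∅`.  UPSTAIRS (for the rung author, by name): EQ datum ⇐ `Equinodal.exists_equinodal_lift` (✓ p670351) fed by `EqCertAt₀` at n = 3; (pt) at a
marked node ⇐ ✓ K3″ `Sections.modelPointStep_of_section` with the node section; (rd) ⇐ ✓ p661929 `hround_seam` (Defs7 clause verbatim); node chart ⇒ EQ3 ⇐
`Equinodal.node_strictTransform_of_equinodal` (…NatEquinodalNodeChart) over ✓ p669509; HNOSE on the given centre ⇐ HT2′-shape round (stub-2 §E); tail ⇐ HSUBʰ.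

MEANING of `EqCertAt₀ k n ℓ Z hZ` ((CERT-EQ) at stage 0, CONCRETE — everything a specimen check computes by linear algebra): hyperplane coordinates `B`
(`ℓ ∘ B = 0`, an invertible `n × n` minor), ONE squarefree form `g` of degree `e` with `Z = V₊(ℓ) ∩ V₊(g)` as a set (so `V(g|_Π)` is `Z` with its reduced
structure), `δ` marked vectors `v i` with third coordinate `1` at which `g|_Π` and all its partials vanish and the affine Hessian block in the first two
coordinates is non-zero (ORDINARY double point, every characteristic incl. 2), which COVER the non-regular closed points of `Z̃` (`IsCoordVecOf`), and which
impose independent conditions on the degree-`e` forms on `Π` (evaluation SURJECTIVE onto `k^δ`; determinant form `EqCertDet`: `δ` degree-`e` monomials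
with invertible evaluation matrix — the shape of res-L1-w45b-nose-w4's integer certificate ✓ p668565 for S_ν(6;10)^{Ch}).
-/

set_option linter.dupNamespace false
noncomputable section
open CategoryTheory CategoryTheory.Limits AlgebraicGeometry TopologicalSpace Topology IsLocalRing
open Literature.AlgebraicGeometry.Resolution
open AlgebraicGeometry.Scheme.IdealSheafData
namespace Summit.ResolutionOfSingularities.ResolutionOfSingularities.Cruxes.EquisingularLiftNat.Sections

/-- «`w : Fin (n+1) → k` is a homogeneous coordinate vector of the point `y` of `ℙⁿ_k`»: a homogeneous polynomial lies in the point's relevant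
homogeneous prime iff it vanishes at `w` (for `k = k̄` and `y` closed this pins `y`; `w ≠ 0` is forced since the irrelevant ideal is not contained in
`y.asHomogeneousIdeal`).  Pure `MvPolynomial`/`ProjectiveSpectrum` currency (idea-3 sketch 0efc2d2c05e81442 verbatim). [OURS · named statement fragment] -/
def IsCoordVecOf (k : Type) [Field k] (n : ℕ) (w : Fin (n + 1) → k)
    (y : (Literature.AlgebraicGeometry.Motives.projectiveSpace n k).left) : Prop :=
  letI := MvPolynomial.gradedAlgebra (σ := Fin (n + 1)) (R := k)
  ∀ (d : ℕ) (f : MvPolynomial (Fin (n + 1)) k), f.IsHomogeneous d →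
    (f ∈ (y : ProjectiveSpectrum (MvPolynomial.homogeneousSubmodule (Fin (n + 1)) k)).asHomogeneousIdeal ↔
      MvPolynomial.eval w f = 0)

/-- restriction of an `(n+1)`-ary polynomial to the hyperplane with coordinate matrix `B` (columns = a basis of `ker ℓ`): `g ↦ g(B·X)`, an `n`-ary polynomial
(homogeneous of the same degree when `g` is) (idea-3 sketch verbatim). [OURS · named statement fragment] -/
def restrictToHyperplane {k : Type} [Field k] {n : ℕ} (B : Fin (n + 1) → Fin n → k)
    (g : MvPolynomial (Fin (n + 1)) k) : MvPolynomial (Fin n) k :=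
  MvPolynomial.aeval (fun a : Fin (n + 1) => ∑ j : Fin n, MvPolynomial.C (B a j) * MvPolynomial.X j) g

/-- the affine Hessian `2 × 2` block `H_aa·H_bb − H_ab²` of an `n`-ary form `h` at the vector `v` in the coordinates `a, b` (= `4AC − B²` for the tangent cone
`A u² + B uv + C v²` when `v` is a singular point in the chart complementary to `a, b`; non-zero iff the double point is ORDINARY, every characteristic incl. 2;
with `a = 0, b = 1` it is literally the `hord` clause of `Equinodal.exists_equinodal_lift`) (idea-3 sketch verbatim). [OURS · named statement fragment] -/
def hessBlock {k : Type} [Field k] {n : ℕ} (h : MvPolynomial (Fin n) k) (a b : Fin n) (v : Fin n → k) : k :=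
  MvPolynomial.eval v (MvPolynomial.pderiv a (MvPolynomial.pderiv a h)) * MvPolynomial.eval v (MvPolynomial.pderiv b (MvPolynomial.pderiv b h))
    - MvPolynomial.eval v (MvPolynomial.pderiv a (MvPolynomial.pderiv b h)) ^ 2

/-- **`EqCertAt₀ k n ℓ Z hZ`** — the certificate (CERT-EQ) of door ν4 at the INITIAL stage with host `Π = V₊(ℓ)`, CONCRETE form (idea-3 sketch 0efc2d2c05e81442
with the per-node charts `c i, a i, b i` replaced by ONE global chart per nose-w4 l.83589 / crit-3 S-1: `c.val = 2`, Hessian in `a.val = 0, b.val = 1`; the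
customer's free choice of the hyperplane coordinates `B` puts finitely many nodes off the line `x₂ = 0`; for `n = 3` this is `(c, a, b) = (2, 0, 1)`, the input
convention of `Equinodal.exists_equinodal_lift`).  See the module docstring for the clause-by-clause meaning.  n = 3 meant (for `n ≥ 4` the pair `a, b` does
not characterise a plane double point — but then the door's host clause is unsatisfiable anyway). [OURS · named hypothesis fragment · candidate] -/
def EqCertAt₀ (k : Type) [Field k] (n : ℕ) (ℓ : MvPolynomial (Fin (n + 1)) k)
    (Z : Set (Literature.AlgebraicGeometry.Motives.projectiveSpace n k).left) (hZ : IsClosed Z) : Prop :=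
  letI := MvPolynomial.gradedAlgebra (σ := Fin (n + 1)) (R := k)
  ∃ (e δ : ℕ) (g : MvPolynomial (Fin (n + 1)) k) (B : Fin (n + 1) → Fin n → k)
    (c a b : Fin n) (v : Fin δ → Fin n → k),
    -- the nose is cut out, as a set, by the hyperplane and ONE SQUAREFREE form of degree `e` on it (so `V(g|_Π)` is `Z` with its reduced structure)
    g.IsHomogeneous e ∧ Squarefree (restrictToHyperplane B g) ∧
    Z = {y | ℓ ∈ (y : ProjectiveSpectrum (MvPolynomial.homogeneousSubmodule (Fin (n + 1)) k)).asHomogeneousIdeal ∧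
             g ∈ (y : ProjectiveSpectrum (MvPolynomial.homogeneousSubmodule (Fin (n + 1)) k)).asHomogeneousIdeal} ∧
    -- `B` = homogeneous coordinates on the hyperplane: `ℓ ∘ B = 0`, rank `n`
    restrictToHyperplane B ℓ = 0 ∧
    (∃ r : Fin n → Fin (n + 1), Function.Injective r ∧ (Matrix.of fun j j' : Fin n => B (r j) j').det ≠ 0) ∧
    -- ONE global chart: the marked vectors are normalised in the third coordinate, the Hessian block is taken in the first two
    ((c : ℕ) = 2 ∧ (a : ℕ) = 0 ∧ (b : ℕ) = 1) ∧
    -- the marked vectors: singular points of `g|_Π`, ORDINARY (non-zero Hessian block)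
    (∀ i, v i c = 1 ∧
      MvPolynomial.eval (v i) (restrictToHyperplane B g) = 0 ∧
      (∀ j, MvPolynomial.eval (v i) (MvPolynomial.pderiv j (restrictToHyperplane B g)) = 0) ∧
      hessBlock (restrictToHyperplane B g) a b (v i) ≠ 0) ∧
    -- they COVER the non-regular closed points of the reduced curve `Z̃`
    (∀ z : ↥(redSub _ Z hZ), IsClosed ({z} : Set ↥(redSub _ Z hZ)) →
      ¬ IsRegularLocalRing ((redSub _ Z hZ).presheaf.stalk z) →
      ∃ i, IsCoordVecOf k n (fun s => ∑ j, B s j * v i j) (redSubι _ Z hZ z)) ∧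
    -- (CERT-EQ): the marked vectors impose independent conditions on the forms of degree `e` on the hyperplane
    Function.Surjective (fun h : MvPolynomial.homogeneousSubmodule (Fin n) k e =>
      fun i => MvPolynomial.eval (v i) (h : MvPolynomial (Fin n) k))

/-- the DETERMINANT form of (CERT-EQ) (what a specimen check computes and what `Equinodal.exists_equinodal_lift_of_det` consumes): `δ` exponent vectors of
degree `e` with invertible evaluation matrix at the marked vectors.  It implies the surjectivity conjunct of `EqCertAt₀` (the `δ` monomials already span a
`δ`-dimensional image); conversely surjectivity gives such pivots (`Equinodal.exists_pivots_of_surjective`, ✓ p670351) (idea-3 sketch verbatim).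
[OURS · named statement fragment] -/
def EqCertDet {k : Type} [Field k] {n : ℕ} (e δ : ℕ) (v : Fin δ → Fin n → k) : Prop :=
  ∃ m : Fin δ → (Fin n →₀ ℕ), (∀ j, (m j).degree = e) ∧
    (Matrix.of fun i j => MvPolynomial.eval (v i) (MvPolynomial.monomial (m j) (1 : k))).det ≠ 0

/-- **`ReachEquinodalPlanarNose k n ℓ T₁ F₉ β T₉ E₉`** — door ν4 «EQUINODAL PLANAR NOSE», INITIAL STAGE, host the hyperplane `Π = V₊(ℓ)` of `ℙⁿ_k`; same
currency as `ReachHostedNoseBTriplePrime` (…NatResidueHypDefs6): the reached stage is `(F₉, β : F₉ ⟶ ℙⁿ, T₉, E₉)` with the host dropped (`E₉ = ∅`).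
Template: idea-2 Sketch v3 1d7d57a44f30e82a l.77, with (i) the node predicate and the finiteness clause REPLACED by the concrete certificate
`EqCertAt₀ k n ℓ Z hZ` (marked ordinary nodes covering the non-regular points + (CERT-EQ)), (ii) the inner motive ALSO closed under the stage-level HOSTED
ROUND of …NatResidueHypDefs7 (binder list verbatim, with the nose transform `W` carried along: `W ↦ closure (υ'⁻¹(W ∖ Z'))`) — §C C1.3's delta, so that
the lines `ℓᵢ = Eᵢ ∩ St Π` are rounded before the nose round.  See the module docstring for the move-by-move meaning and the upstairs suppliers.
[OURS · named hypothesis fragment, no mathematical content of its own] -/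
def ReachEquinodalPlanarNose (k : Type) [Field k] (n : ℕ) (ℓ : MvPolynomial (Fin (n + 1)) k)
    (T₁ : Set (Literature.AlgebraicGeometry.Motives.projectiveSpace n k).left) (F₉ : Scheme.{0}) (β : F₉ ⟶ (Literature.AlgebraicGeometry.Motives.projectiveSpace n k).left) (T₉ E₉ : Set F₉) : Prop :=
  letI := MvPolynomial.gradedAlgebra (σ := Fin (n + 1)) (R := k)
  E₉ = ∅ ∧
  ∃ (Z : Set (Literature.AlgebraicGeometry.Motives.projectiveSpace n k).left) (hZ : IsClosed Z),
    Z ⊆ T₁ ∧ ¬ (T₁ ⊆ Z) ∧ Z.Infinite ∧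
    Z ⊆ {y : (Literature.AlgebraicGeometry.Motives.projectiveSpace n k).left | ℓ ∈ (y : ProjectiveSpectrum (MvPolynomial.homogeneousSubmodule (Fin (n + 1)) k)).asHomogeneousIdeal} ∧
    IsPreirreducible Z ∧
    -- curve clause
    (∀ z : ↥(redSub (Literature.AlgebraicGeometry.Motives.projectiveSpace n k).left Z hZ), IsClosed ({z} : Set ↥(redSub (Literature.AlgebraicGeometry.Motives.projectiveSpace n k).left Z hZ)) →
      ringKrullDim ((redSub (Literature.AlgebraicGeometry.Motives.projectiveSpace n k).left Z hZ).presheaf.stalk z) = ((1 : ℕ) : WithBot ℕ∞)) ∧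
    -- ambient regular along `Z̃`
    (∀ (i : redSub (Literature.AlgebraicGeometry.Motives.projectiveSpace n k).left Z hZ ⟶ redSub (Literature.AlgebraicGeometry.Motives.projectiveSpace n k).left Set.univ isClosed_univ), i ≫ redSubι (Literature.AlgebraicGeometry.Motives.projectiveSpace n k).left Set.univ isClosed_univ = redSubι (Literature.AlgebraicGeometry.Motives.projectiveSpace n k).left Z hZ →
      ∀ z : ↥(redSub (Literature.AlgebraicGeometry.Motives.projectiveSpace n k).left Z hZ), IsRegularLocalRing ((redSub (Literature.AlgebraicGeometry.Motives.projectiveSpace n k).left Set.univ isClosed_univ).presheaf.stalk (i.base z))) ∧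
    -- host regular along `Z̃`
    (∀ (i : redSub (Literature.AlgebraicGeometry.Motives.projectiveSpace n k).left Z hZ ⟶ redSub (Literature.AlgebraicGeometry.Motives.projectiveSpace n k).left (closure {y : (Literature.AlgebraicGeometry.Motives.projectiveSpace n k).left | ℓ ∈ (y : ProjectiveSpectrum (MvPolynomial.homogeneousSubmodule (Fin (n + 1)) k)).asHomogeneousIdeal}) isClosed_closure),
      i ≫ redSubι (Literature.AlgebraicGeometry.Motives.projectiveSpace n k).left (closure {y : (Literature.AlgebraicGeometry.Motives.projectiveSpace n k).left | ℓ ∈ (y : ProjectiveSpectrum (MvPolynomial.homogeneousSubmodule (Fin (n + 1)) k)).asHomogeneousIdeal}) isClosed_closure = redSubι (Literature.AlgebraicGeometry.Motives.projectiveSpace n k).left Z hZ →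
      ∀ z : ↥(redSub (Literature.AlgebraicGeometry.Motives.projectiveSpace n k).left Z hZ), IsRegularLocalRing ((redSub (Literature.AlgebraicGeometry.Motives.projectiveSpace n k).left (closure {y : (Literature.AlgebraicGeometry.Motives.projectiveSpace n k).left | ℓ ∈ (y : ProjectiveSpectrum (MvPolynomial.homogeneousSubmodule (Fin (n + 1)) k)).asHomogeneousIdeal}) isClosed_closure).presheaf.stalk (i.base z))) ∧
    -- host two-dimensional along `Z` (n = 3 in effect)
    (∀ e : ↥(redSub (Literature.AlgebraicGeometry.Motives.projectiveSpace n k).left (closure {y : (Literature.AlgebraicGeometry.Motives.projectiveSpace n k).left | ℓ ∈ (y : ProjectiveSpectrum (MvPolynomial.homogeneousSubmodule (Fin (n + 1)) k)).asHomogeneousIdeal}) isClosed_closure),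
      IsClosed ({e} : Set ↥(redSub (Literature.AlgebraicGeometry.Motives.projectiveSpace n k).left (closure {y : (Literature.AlgebraicGeometry.Motives.projectiveSpace n k).left | ℓ ∈ (y : ProjectiveSpectrum (MvPolynomial.homogeneousSubmodule (Fin (n + 1)) k)).asHomogeneousIdeal}) isClosed_closure)) →
      (redSubι (Literature.AlgebraicGeometry.Motives.projectiveSpace n k).left (closure {y : (Literature.AlgebraicGeometry.Motives.projectiveSpace n k).left | ℓ ∈ (y : ProjectiveSpectrum (MvPolynomial.homogeneousSubmodule (Fin (n + 1)) k)).asHomogeneousIdeal}) isClosed_closure e : (Literature.AlgebraicGeometry.Motives.projectiveSpace n k).left) ∈ Z →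
      ringKrullDim ((redSub (Literature.AlgebraicGeometry.Motives.projectiveSpace n k).left (closure {y : (Literature.AlgebraicGeometry.Motives.projectiveSpace n k).left | ℓ ∈ (y : ProjectiveSpectrum (MvPolynomial.homogeneousSubmodule (Fin (n + 1)) k)).asHomogeneousIdeal}) isClosed_closure).presheaf.stalk e) = ((2 : ℕ) : WithBot ℕ∞)) ∧
    -- the certificate (CERT-EQ), concrete: marked ORDINARY nodes covering the non-regular points, independent conditions on degree-`e` forms
    EqCertAt₀ k n ℓ Z hZ ∧
    -- THE SUB-CHAIN: inner motive `R G γ T E W` closed under (pt) point steps at non-regular points of `W̃` and (rd) Defs7's stage-level hosted round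
    ∃ (F₂ : Scheme.{0}) (υ : F₂ ⟶ (Literature.AlgebraicGeometry.Motives.projectiveSpace n k).left) (T₂ E₂ Z₂ : Set F₂) (hZ₂ : IsClosed Z₂),
      (∀ R : (∀ G : Scheme.{0}, (G ⟶ (Literature.AlgebraicGeometry.Motives.projectiveSpace n k).left) → Set G → Set G → Set G → Prop),
        R (Literature.AlgebraicGeometry.Motives.projectiveSpace n k).left (𝟙 (Literature.AlgebraicGeometry.Motives.projectiveSpace n k).left) T₁ {y : (Literature.AlgebraicGeometry.Motives.projectiveSpace n k).left | ℓ ∈ (y : ProjectiveSpectrum (MvPolynomial.homogeneousSubmodule (Fin (n + 1)) k)).asHomogeneousIdeal} Z →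
        -- (pt) the blow-up of a NON-REGULAR closed point of the nose transform `W̃`, regular on the ambient and on the host when it lies in it
        --      (hypothesis shape = …NatResidueHypDefs7's point-step clause, with `W` carried along)
        (∀ (G G' : Scheme.{0}) (γ : G ⟶ (Literature.AlgebraicGeometry.Motives.projectiveSpace n k).left) (T E W : Set G) (hW : IsClosed W) (w : ↥(redSub G W hW)) (υ₁ : G' ⟶ G)
            (hy : IsClosed ({(redSubι G W hW w : G)} : Set G)),
          R G γ T E W → ¬ IsRegularLocalRing ((redSub G W hW).presheaf.stalk w) →
          IsRegularLocalRing (G.presheaf.stalk (redSubι G W hW w : G)) →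
          ((redSubι G W hW w : G) ∈ closure E → ∀ e : ↥(redSub G (closure E) isClosed_closure),
            (redSubι G (closure E) isClosed_closure e : G) = (redSubι G W hW w : G) →
            IsRegularLocalRing ((redSub G (closure E) isClosed_closure).presheaf.stalk e)) →
          IsBlowup υ₁ (vanishingIdeal (⟨{(redSubι G W hW w : G)}, hy⟩ : Closeds G)) →
          R G' (υ₁ ≫ γ) (closure (υ₁ ⁻¹' (T \ {(redSubι G W hW w : G)}))) (closure (υ₁ ⁻¹' (E \ {(redSubι G W hW w : G)})))
            (closure (υ₁ ⁻¹' (W \ {(redSubι G W hW w : G)})))) →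
        -- (rd) STAGE-LEVEL HOSTED ROUND at a regular curve `Z'` inside the host, unobstructed IN THE HOST (…NatResidueHypDefs7's binder list verbatim; `W` carried along)
        (∀ (G G' : Scheme.{0}) (γ : G ⟶ (Literature.AlgebraicGeometry.Motives.projectiveSpace n k).left) (T E W : Set G) (Z' : Set G) (hZ' : IsClosed Z') (υ' : G' ⟶ G),
          R G γ T E W → Z' ⊆ closure E → Z' ⊆ T → ¬ T ⊆ Z' → (∀ z : ↥(redSub G Z' hZ'), IsRegularLocalRing ((redSub G Z' hZ').presheaf.stalk z)) →
          (∀ (i : redSub G Z' hZ' ⟶ redSub G (closure E) isClosed_closure), i ≫ redSubι G (closure E) isClosed_closure = redSubι G Z' hZ' →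
            ∀ z : ↥(redSub G Z' hZ'), IsRegularLocalRing ((redSub G (closure E) isClosed_closure).presheaf.stalk (i z))) → DirStepUnobs G (closure E) isClosed_closure Z' hZ' →
          (∀ z : ↥(redSub G Z' hZ'), IsClosed ({z} : Set ↥(redSub G Z' hZ')) → ringKrullDim ((redSub G Z' hZ').presheaf.stalk z) = ((1 : ℕ) : WithBot ℕ∞)) →
          IsBlowup υ' (vanishingIdeal (⟨Z', hZ'⟩ : Closeds G)) →
          R G' (υ' ≫ γ) (closure (υ' ⁻¹' (T \ Z'))) (closure (υ' ⁻¹' (closure E \ Z'))) (closure (υ' ⁻¹' (W \ Z')))) →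
        R F₂ υ T₂ E₂ Z₂) ∧
      -- the nose transform is REGULAR at the reached stage …
      (∀ z : ↥(redSub F₂ Z₂ hZ₂), IsRegularLocalRing ((redSub F₂ Z₂ hZ₂).presheaf.stalk z)) ∧
      -- … and is blown up (NO unobstructedness clause: upstairs the centre is the GIVEN strict transform of the equinodal lift), then a B‴ tail
      ∃ (F₃ : Scheme.{0}) (υ' : F₃ ⟶ F₂), IsBlowup υ' (vanishingIdeal (⟨Z₂, hZ₂⟩ : Closeds F₂)) ∧
        ∃ (γ' : F₉ ⟶ F₃) (E' : Set F₉) (Es' Ns' : List (Set F₉)) (K' : Set F₉),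
          (∀ R : (∀ G : Scheme.{0}, (G ⟶ F₃) → Set G → Set G → List (Set G) → List (Set G) → Set G → Prop),
            R F₃ (𝟙 F₃) (closure (υ' ⁻¹' (T₂ \ Z₂))) (υ' ⁻¹' Z₂) [] [] ∅ →
            TowerPtRegB₄ F₃ R → TowerPtRamB₄ F₃ R → TowerRoundBTriplePrime F₂ F₃ υ' Z₂ hZ₂ R →
            R F₉ γ' T₉ E' Es' Ns' K') ∧
          β = (γ' ≫ υ') ≫ υ

/-- **`NoseHypHostedNestEquinodalBTriplePrime k n H ι`** (blob₃ᵉ, door ν4 «EQUINODAL PLANAR NOSE») — `NoseHypHostedNestBTriplePrime₂` (…NatResidueHypDefs7, ✓ p661915)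
VERBATIM (the `E₀` binder, the point-step clause, the stage-level hosted-round clause, the `ReachHostedNoseBTriplePrime` clause, the regular end), the motive `Q`
being ADDITIONALLY closed under ONE initial-stage rule: when the host is the hyperplane `E₀ = V₊(ℓ)`, `ReachEquinodalPlanarNose k n ℓ (range ι) F₉ β T₉ E₉`
transports `Q` from `(ℙⁿ, 𝟙, range ι, E₀)` to `(F₉, β, T₉, E₉)`.  More closure asked of `Q` ⇒ implied by blob₂ (`…_of_hostedNest₂` below, pure logic).
Rung shape (R-ν4ᵉ, lead-2 (D6-6)): the registered nose residue's binders with last hypothesis THIS blob ⊢ `ELNatConclusionO k n H ι`; the 41st =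
REPLACE `¬ NoseHypHostedNestBTriplePrime₂ ↦ ¬ NoseHypHostedNestEquinodalBTriplePrime`.  n-SCOPE: the door's host-dimension and curve clauses make the
extra rule fire only for n = 3 (harmless for PARENT, count-neutral).  See the module docstring.
[OURS · L1 W4.5b · named hypothesis, no mathematical content of its own] -/
def NoseHypHostedNestEquinodalBTriplePrime (k : Type) [Field k] [IsAlgClosed k] (n : ℕ) (H : AlgebraicGeometry.Scheme.{0})
    (ι : H ⟶ (Literature.AlgebraicGeometry.Motives.projectiveSpace n k).left) : Prop :=
  letI := MvPolynomial.gradedAlgebra (σ := Fin (n + 1)) (R := k)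
  ∃ (E₀ : Set (Literature.AlgebraicGeometry.Motives.projectiveSpace n k).left),
    (E₀ = ∅ ∨ ∃ ℓ : MvPolynomial (Fin (n + 1)) k, ℓ.IsHomogeneous 1 ∧ ℓ ≠ 0 ∧
      ¬ (Set.range ι ⊆ {y : (Literature.AlgebraicGeometry.Motives.projectiveSpace n k).left |
        ℓ ∈ (y : ProjectiveSpectrum (MvPolynomial.homogeneousSubmodule (Fin (n + 1)) k)).asHomogeneousIdeal}) ∧
      E₀ = {y : (Literature.AlgebraicGeometry.Motives.projectiveSpace n k).left |
        ℓ ∈ (y : ProjectiveSpectrum (MvPolynomial.homogeneousSubmodule (Fin (n + 1)) k)).asHomogeneousIdeal}) ∧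
    (∃ (F' : AlgebraicGeometry.Scheme.{0}) (ρ' : F' ⟶ (Literature.AlgebraicGeometry.Motives.projectiveSpace n k).left) (T' : Set F'),
      (∀ Q : (∀ F₁ : AlgebraicGeometry.Scheme.{0}, (F₁ ⟶ (Literature.AlgebraicGeometry.Motives.projectiveSpace n k).left) → Set F₁ → Set F₁ → Prop),
        Q (Literature.AlgebraicGeometry.Motives.projectiveSpace n k).left (𝟙 (Literature.AlgebraicGeometry.Motives.projectiveSpace n k).left) (Set.range ι) E₀ →
        (∀ (F₁ F₂ : AlgebraicGeometry.Scheme.{0}) (ρ : F₁ ⟶ (Literature.AlgebraicGeometry.Motives.projectiveSpace n k).left) (T₁ E₁ : Set F₁)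
            (x : ↥((AlgebraicGeometry.Scheme.IdealSheafData.vanishingIdeal (⟨closure T₁, isClosed_closure⟩ : TopologicalSpace.Closeds F₁))).subscheme) (υ : F₂ ⟶ F₁) (hx : IsClosed ({(((AlgebraicGeometry.Scheme.IdealSheafData.vanishingIdeal (⟨closure T₁, isClosed_closure⟩ : TopologicalSpace.Closeds F₁))).subschemeι x : F₁)} : Set F₁)),
          Q F₁ ρ T₁ E₁ → ¬ IsRegularLocalRing (((AlgebraicGeometry.Scheme.IdealSheafData.vanishingIdeal (⟨closure T₁, isClosed_closure⟩ : TopologicalSpace.Closeds F₁))).subscheme.presheaf.stalk x) →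
          IsRegularLocalRing (F₁.presheaf.stalk (((AlgebraicGeometry.Scheme.IdealSheafData.vanishingIdeal (⟨closure T₁, isClosed_closure⟩ : TopologicalSpace.Closeds F₁))).subschemeι x : F₁)) →
          ((((AlgebraicGeometry.Scheme.IdealSheafData.vanishingIdeal (⟨closure T₁, isClosed_closure⟩ : TopologicalSpace.Closeds F₁))).subschemeι x : F₁) ∈ closure E₁ → ∀ e : ↥(redSub F₁ (closure E₁) isClosed_closure), (redSubι F₁ (closure E₁) isClosed_closure e : F₁) = (((AlgebraicGeometry.Scheme.IdealSheafData.vanishingIdeal (⟨closure T₁, isClosed_closure⟩ : TopologicalSpace.Closeds F₁))).subschemeι x : F₁) →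
          IsRegularLocalRing ((redSub F₁ (closure E₁) isClosed_closure).presheaf.stalk e)) → Literature.AlgebraicGeometry.Resolution.IsBlowup υ
            (AlgebraicGeometry.Scheme.IdealSheafData.vanishingIdeal (⟨{(((AlgebraicGeometry.Scheme.IdealSheafData.vanishingIdeal (⟨closure T₁, isClosed_closure⟩ : TopologicalSpace.Closeds F₁))).subschemeι x : F₁)}, hx⟩ : TopologicalSpace.Closeds F₁)) →
          Q F₂ (υ ≫ ρ) (closure (υ ⁻¹' (T₁ \ {(((AlgebraicGeometry.Scheme.IdealSheafData.vanishingIdeal (⟨closure T₁, isClosed_closure⟩ : TopologicalSpace.Closeds F₁))).subschemeι x : F₁)}))) (closure (υ ⁻¹' (E₁ \ {(((AlgebraicGeometry.Scheme.IdealSheafData.vanishingIdeal (⟨closure T₁, isClosed_closure⟩ : TopologicalSpace.Closeds F₁))).subschemeι x : F₁)})))) →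
        -- STAGE-LEVEL HOSTED ROUND at a regular curve `Z` inside the host, unobstructed IN THE HOST (in-host NEST lines and the nose curve alike)
        (∀ (F₁ F₃ : AlgebraicGeometry.Scheme.{0}) (ρ : F₁ ⟶ (Literature.AlgebraicGeometry.Motives.projectiveSpace n k).left) (T₁ E₁ : Set F₁) (Z : Set F₁) (hZ : IsClosed Z) (υ' : F₃ ⟶ F₁),
          Q F₁ ρ T₁ E₁ → Z ⊆ closure E₁ → Z ⊆ T₁ → ¬ T₁ ⊆ Z → (∀ z : ↥(redSub F₁ Z hZ), IsRegularLocalRing ((redSub F₁ Z hZ).presheaf.stalk z)) →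
          (∀ (i : redSub F₁ Z hZ ⟶ redSub F₁ (closure E₁) isClosed_closure), i ≫ redSubι F₁ (closure E₁) isClosed_closure = redSubι F₁ Z hZ →
            ∀ z : ↥(redSub F₁ Z hZ), IsRegularLocalRing ((redSub F₁ (closure E₁) isClosed_closure).presheaf.stalk (i z))) → DirStepUnobs F₁ (closure E₁) isClosed_closure Z hZ →
          (∀ z : ↥(redSub F₁ Z hZ), IsClosed ({z} : Set ↥(redSub F₁ Z hZ)) → ringKrullDim ((redSub F₁ Z hZ).presheaf.stalk z) = ((1 : ℕ) : WithBot ℕ∞)) →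
          Literature.AlgebraicGeometry.Resolution.IsBlowup υ' (AlgebraicGeometry.Scheme.IdealSheafData.vanishingIdeal (⟨Z, hZ⟩ : TopologicalSpace.Closeds F₁)) →
          Q F₃ (υ' ≫ ρ) (closure (υ' ⁻¹' (T₁ \ Z))) (closure (υ' ⁻¹' (closure E₁ \ Z)))) →
        (∀ (F₁ : AlgebraicGeometry.Scheme.{0}) (ρ : F₁ ⟶ (Literature.AlgebraicGeometry.Motives.projectiveSpace n k).left) (T₁ E₁ : Set F₁) (F₉ : AlgebraicGeometry.Scheme.{0}) (β : F₉ ⟶ F₁) (T₉ E₉ : Set F₉),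
          Q F₁ ρ T₁ E₁ → ReachHostedNoseBTriplePrime F₁ T₁ E₁ F₉ β T₉ E₉ → Q F₉ (β ≫ ρ) T₉ E₉) →
        -- INITIAL-STAGE EQUINODAL PLANAR NOSE inside the hyperplane host `E₀ = V₊(ℓ)` (door `ReachEquinodalPlanarNose`, certificate (CERT-EQ) concrete = `EqCertAt₀`):
        -- the sub-chain blows up the marked nodes itself, rounds the in-host lines, then the nose round on the transform and a B‴ tail; unavailable when `E₀ = ∅`
        (∀ (ℓ : MvPolynomial (Fin (n + 1)) k) (F₉ : AlgebraicGeometry.Scheme.{0}) (β : F₉ ⟶ (Literature.AlgebraicGeometry.Motives.projectiveSpace n k).left) (T₉ E₉ : Set F₉),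
          Q (Literature.AlgebraicGeometry.Motives.projectiveSpace n k).left (𝟙 (Literature.AlgebraicGeometry.Motives.projectiveSpace n k).left) (Set.range ι) E₀ →
          E₀ = {y : (Literature.AlgebraicGeometry.Motives.projectiveSpace n k).left |
            ℓ ∈ (y : ProjectiveSpectrum (MvPolynomial.homogeneousSubmodule (Fin (n + 1)) k)).asHomogeneousIdeal} →
          ReachEquinodalPlanarNose k n ℓ (Set.range ι) F₉ β T₉ E₉ → Q F₉ β T₉ E₉) → ∃ E' : Set F', Q F' ρ' T' E') ∧
      Literature.AlgebraicGeometry.Resolution.Scheme.IsRegular (AlgebraicGeometry.Scheme.IdealSheafData.vanishingIdeal (⟨closure T', isClosed_closure⟩ : TopologicalSpace.Closeds F')).subscheme)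

/-- blob₂ ⇒ blob₃ᵉ: `NoseHypHostedNestEquinodalBTriplePrime` asks MORE closure of the motive (the extra initial-stage rule), so every motive it
quantifies over is one blob₂ already transports to the regular end; the extra hypothesis is simply not used. [OURS · pure logic] -/
theorem noseHypHostedNestEquinodalBTriplePrime_of_hostedNest₂ (k : Type) [Field k] [IsAlgClosed k] (n : ℕ) (H : AlgebraicGeometry.Scheme.{0})
    (ι : H ⟶ (Literature.AlgebraicGeometry.Motives.projectiveSpace n k).left) (h : NoseHypHostedNestBTriplePrime₂ k n H ι) :
    NoseHypHostedNestEquinodalBTriplePrime k n H ι := by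
  obtain ⟨E₀, hE₀, F', ρ', T', hQ, hreg⟩ := h
  exact ⟨E₀, hE₀, F', ρ', T', fun Q hQ0 hpt hround hreach _ => hQ Q hQ0 hpt hround hreach, hreg⟩

/-- Contrapositive form, as the REPLACE cut (41st: `¬ NoseHypHostedNestBTriplePrime₂ ↦ ¬ NoseHypHostedNestEquinodalBTriplePrime` on the registered nose
residue) consumes it: `¬ blob₃ᵉ → ¬ blob₂`. [OURS · pure logic] -/
theorem not_noseHypHostedNestBTriplePrime₂_of_not_hostedNestEquinodal (k : Type) [Field k] [IsAlgClosed k] (n : ℕ)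
    (H : AlgebraicGeometry.Scheme.{0}) (ι : H ⟶ (Literature.AlgebraicGeometry.Motives.projectiveSpace n k).left)
    (h : ¬ NoseHypHostedNestEquinodalBTriplePrime k n H ι) : ¬ NoseHypHostedNestBTriplePrime₂ k n H ι :=
  fun h' => h (noseHypHostedNestEquinodalBTriplePrime_of_hostedNest₂ k n H ι h')

/-- … hence also `¬ blob₃ᵉ → ¬ NoseHypPointsFirstBTriplePrime` (through …NatResidueHypDefs7's inclusion), for texts that still carry (H-ν2). [OURS · pure logic] -/
theorem not_noseHypPointsFirstBTriplePrime_of_not_hostedNestEquinodal (k : Type) [Field k] [IsAlgClosed k] (n : ℕ)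
    (H : AlgebraicGeometry.Scheme.{0}) (ι : H ⟶ (Literature.AlgebraicGeometry.Motives.projectiveSpace n k).left)
    (h : ¬ NoseHypHostedNestEquinodalBTriplePrime k n H ι) : ¬ NoseHypPointsFirstBTriplePrime k n H ι :=
  not_noseHypPointsFirstBTriplePrime_of_not_hostedNest₂ k n H ι
    (not_noseHypHostedNestBTriplePrime₂_of_not_hostedNestEquinodal k n H ι h)

end Summit.ResolutionOfSingularities.ResolutionOfSingularities.Cruxes.EquisingularLiftNat.Sections

end
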